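import Literature.AlgebraicGeometry.Resolution.ValuedFunctionFields
import HarnessLib

/-!
# Two embeddings inducing the same valuation ring induce the same values (value-torsion case)

Topic: `Literature/AlgebraicGeometry/Resolution` (valued function fields). Groundwork for the
algebraization step of M. Temkin, *Inseparable local uniformization*, J. Algebra 373 (2013) =
arXiv:0804.1554v3, Thm. 3.3.1 (tree: `Temkin2013RelativeCurveSmoothFibre`). The placement of
function-field elements by powers of a separating unit (`PlacementBySeparatingUnit.lean`) needs,
for each embedding `θ : L → Ω` of the finite family, the dichotomy "`θ` induces the SAME VALUES as
the reference embedding `θ₀`, or `|θ s| < 1`". The separating unit gives `|θ s| < 1` whenever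
`θ` induces a valuation RING different from that of `θ₀`; this file supplies the other branch:
if `V.comap θ = V.comap θ₀` and the value group of `L` is torsion over the values of a subfield
on which `θ` and `θ₀` agree (the constants: Temkin's "`K/k` transcendentally immediate",
`|K^×| ⊗ ℚ = |k^×| ⊗ ℚ`), then `|θ y| = |θ₀ y|` for all `y` — the `n`-th powers agree, being the
value of a constant times a unit, and `n`-th powers are injective in the value group.

* `valuation_apply_eq_of_comap_eq` — abstract form (torsion witnessed by elements `c` with
  `θ c = θ₀ c`) — PROVED;
* `valuation_apply_eq_of_comap_eq_of_isValueTorsionOver` — the form with constants `k → L` and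
  the tree's `IsValueTorsionOver` for the images in `Ω` — PROVED.

All statements are [folklore]; no definitions, no named facts.

## Sources

* M. Temkin, arXiv:0804.1554v3, §2.1 (transcendentally/essentially immediate extensions) and
  the proof of Thm. 3.3.1 (the use).
* F.-V. Kuhlmann, H. Knaf, Adv. Math. 221 (2009), §1 (value-torsion), through the tree
  (`ValuedFunctionFields.lean`).
-/

noncomputable section

namespace Literature.AlgebraicGeometry.Resolution

universe u

variable {Ω : Type u} [Field Ω] (V : ValuationSubring Ω)

section SameValues

variable {L : Type*} [Field L]

/-- A nonzero element lying in the valuation ring together with its inverse has value `1`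
(local copy of a lemma of `FundamentalInequalityApprox.lean`). [folklore] -/
private theorem valuation_eq_one_of_mem_of_inv_mem' {w : Ω} (hw0 : w ≠ 0) (h1 : w ∈ V) (h2 : w⁻¹ ∈ V) :
    V.valuation w = 1 := by
  refine le_antisymm ((V.valuation_le_one_iff _).mpr h1) ?_
  have h3 := (V.valuation_le_one_iff _).mpr h2
  rwa [map_inv₀, inv_le_one₀ ((Valuation.pos_iff _).mpr hw0)] at h3

/-- **Same valuation ring and value torsion ⇒ same values.** Let `θ, θ₀ : L → Ω` be ring
embeddings with `V.comap θ = V.comap θ₀`, and suppose every `y ≠ 0` has a power `yⁿ` (`n ≠ 0`)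
which is `c · u` with `θ c = θ₀ c`, `c ≠ 0`, and `u = yⁿ/c` a unit of `V.comap θ₀`. Then
`|θ y|_V = |θ₀ y|_V` for all `y`. [folklore] -/
theorem valuation_apply_eq_of_comap_eq (θ θ₀ : L →+* Ω) (hring : V.comap θ = V.comap θ₀)
    (htors : ∀ y : L, y ≠ 0 → ∃ n : ℕ, n ≠ 0 ∧ ∃ c : L, c ≠ 0 ∧ θ c = θ₀ c ∧
      θ₀ (y ^ n / c) ∈ V ∧ θ₀ (c / y ^ n) ∈ V)
    (y : L) : V.valuation (θ y) = V.valuation (θ₀ y) := by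
  by_cases hy0 : y = 0
  · rw [hy0, map_zero, map_zero, map_zero, map_zero]
  obtain ⟨n, hn, c, hc0, hθc, hu, hu'⟩ := htors y hy0
  have hyn0 : y ^ n ≠ 0 := pow_ne_zero n hy0
  -- `u = yⁿ/c` is a unit at `V ∘ θ₀` and at `V ∘ θ`
  have hq0 : y ^ n / c ≠ 0 := div_ne_zero hyn0 hc0
  have hu₀ : V.valuation (θ₀ (y ^ n / c)) = 1 := by
    refine valuation_eq_one_of_mem_of_inv_mem' V ((_root_.map_ne_zero θ₀).mpr hq0) hu ?_
    rw [← map_inv₀, inv_div]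
    exact hu'
  have huθ : V.valuation (θ (y ^ n / c)) = 1 := by
    have h1 : y ^ n / c ∈ V.comap θ := by rw [hring]; exact hu
    have h2 : c / y ^ n ∈ V.comap θ := by rw [hring]; exact hu'
    refine valuation_eq_one_of_mem_of_inv_mem' V ((_root_.map_ne_zero θ).mpr hq0) h1 ?_
    rw [← map_inv₀, inv_div]
    exact h2
  -- the `n`-th powers agree
  have hsplit : y ^ n = c * (y ^ n / c) := by rw [mul_div_cancel₀ _ hc0]
  have hpow : V.valuation (θ y) ^ n = V.valuation (θ₀ y) ^ n := by
    rw [← map_pow, ← map_pow, ← map_pow, ← map_pow, hsplit, map_mul, map_mul, map_mul, map_mul,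
      huθ, hu₀, hθc]
  exact (pow_left_inj₀ zero_le zero_le hn).mp hpow

/-- **The form with constants.** Let `k → L` be a field extension, `θ, θ₀ : L → Ω` ring
embeddings agreeing on `k` with `V.comap θ = V.comap θ₀`, and suppose the values of `L` (through
`θ₀`) are torsion over those of `k`: every `y ≠ 0` has `|θ₀ (yⁿ)| = |θ₀ c|` for some `n ≠ 0` and
`c ∈ k`. Then `|θ y| = |θ₀ y|` for all `y`. [folklore] -/
theorem valuation_apply_eq_of_comap_eq_of_torsion {k : Type*} [Field k] [Algebra k L]
    (θ θ₀ : L →+* Ω) (hring : V.comap θ = V.comap θ₀)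
    (hfix : ∀ c : k, θ (algebraMap k L c) = θ₀ (algebraMap k L c))
    (htors : ∀ y : L, y ≠ 0 → ∃ n : ℕ, n ≠ 0 ∧ ∃ c : k,
      V.valuation (θ₀ (y ^ n)) = V.valuation (θ₀ (algebraMap k L c)))
    (y : L) : V.valuation (θ y) = V.valuation (θ₀ y) := by
  refine valuation_apply_eq_of_comap_eq V θ θ₀ hring (fun z hz0 => ?_) y
  obtain ⟨n, hn, c, hc⟩ := htors z hz0
  have hzn0 : z ^ n ≠ 0 := pow_ne_zero n hz0
  have hθzn0 : θ₀ (z ^ n) ≠ 0 := (_root_.map_ne_zero θ₀).mpr hzn0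
  have hc0 : algebraMap k L c ≠ 0 := by
    intro h0
    rw [h0, map_zero, map_zero] at hc
    exact hθzn0 ((map_eq_zero V.valuation).mp hc)
  have hθc0 : θ₀ (algebraMap k L c) ≠ 0 := (_root_.map_ne_zero θ₀).mpr hc0
  have hvc0 : V.valuation (θ₀ (algebraMap k L c)) ≠ 0 := by
    rwa [Ne, map_eq_zero]
  refine ⟨n, hn, algebraMap k L c, hc0, hfix c, ?_, ?_⟩
  · rw [← V.valuation_le_one_iff, map_div₀, map_div₀, hc, div_self hvc0]
  · rw [← V.valuation_le_one_iff, map_div₀, map_div₀, hc, div_self hvc0]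

/-- **The form with the tree's `IsValueTorsionOver`** for the images in `Ω`: `θ₀ = algebraMap`,
`kΩ ≤ LΩ` the images of `k` and `L`, `IsValueTorsionOver V kΩ LΩ`. [folklore] -/
theorem valuation_apply_eq_of_comap_eq_of_isValueTorsionOver {k : Type*} [Field k] [Algebra k L]
    [Algebra L Ω] [Algebra k Ω] [IsScalarTower k L Ω] (θ : L →+* Ω)
    (hring : V.comap θ = V.comap (algebraMap L Ω))
    (hfix : ∀ c : k, θ (algebraMap k L c) = algebraMap k Ω c)
    (htors : IsValueTorsionOver V (algebraMap k Ω).fieldRange (algebraMap L Ω).fieldRange)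
    (y : L) : V.valuation (θ y) = V.valuation (algebraMap L Ω y) := by
  refine valuation_apply_eq_of_comap_eq_of_torsion (k := k) V θ (algebraMap L Ω) hring
    (fun c => ?_) (fun z hz0 => ?_) y
  · rw [hfix, IsScalarTower.algebraMap_apply k L Ω]
  · obtain ⟨n, hn, b, hb, hzb⟩ := htors (algebraMap L Ω z) ⟨z, rfl⟩
      ((_root_.map_ne_zero _).mpr hz0)
    obtain ⟨c, rfl⟩ := hb
    refine ⟨n, hn, c, ?_⟩
    rw [map_pow, hzb, ← IsScalarTower.algebraMap_apply k L Ω]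

end SameValues

end Literature.AlgebraicGeometry.Resolution

end
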